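import Literature.Analysis.FluidPDE.LerayVelocityCubicDecay
import Literature.Analysis.FluidPDE.LocalPressureFarFieldTools
import HarnessLib

/-!
# Uniformly local bookkeeping: from unit balls to balls of radius `ρ`, and the cubic functional
of a field in the uniformly local energy class with explicit constants

Analysis/FluidPDE proof file (theorems only, everything proved), tools for the reduction of the
named fact `Literature.Analysis.FluidPDE.kangMiuraTsai_local_pressure_bound`
(`LocalLerayPressureBound.lean`) to the local pressure expansion and the Calderón–Zygmund bound
(`LocalLerayPressureBoundProofs.lean`). That fact is *quantitative* — one constant
`K = K(T, R, A)` for all local Leray solutions on `(0,T) × ℝ³` whose uniformly local energy on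
**unit** balls is `≤ A` (Kang–Miura–Tsai 2021, §8: "there is `A ∈ (0,∞)` such that
`ess sup_{0<t<T} ‖v(t)‖²_{L²_uloc} + sup_x ∫₀ᵀ∫_{B_1(x)} |∇v|² ≤ A`", and
"`‖p̄_{x₀,R}‖ ≤ c(T,R,s,q) A`") — whereas the tree's cubic bounds for the local Leray classes
(`IsLocalLeraySolutionOn.exists_lintegral_cube_box_le`, `LocalLeraySlabCubicIntegrability.lean`;
`IsLocalLeraySolution.tendsto_lintegral_cube_cocompact`) carry constants built from the
solution's own bounds at the radius at hand. This file supplies the two explicit-constant steps: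

* `setLIntegral_ball_le_of_forall_unitBall` — **`L¹_uloc` at radius `ρ` from radius `1`**: if
  `g ≥ 0` has `∫_{B_1(z)} g ≤ A` for every centre `z`, then `∫_{B_ρ(x₀)} g ≤ |B_1|⁻¹ A |B_{ρ+1}|`
  for every `x₀` and `ρ` (the continuous form of "balls of radius `R' > R` are finite unions of
  balls of radius `R`", by the averaging lemma `lintegral_mul_le_of_forall_lintegral_ball_le` of
  `LocalPressureFarFieldTools.lean` with the weights `1_{B_ρ(x₀)} ≤ 1_{B_{ρ+1}(x₀)}` on unit
  distance);
* `exists_lintegral_cube_box_le_explicit` — **the cubic functional with explicit constants**: for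
  every radius `ρ` there is `K_c = (2 C_S(ρ))^{3/2}` (`C_S(ρ)` the centre-independent Sobolev
  constant of `B_ρ`, `exists_eLpNorm_six_le_ball_uniform`) such that for every field `v` with a
  weak spatial gradient `G` on the slab `(0,T) × ℝ³`, every centre `x₀` and all bounds
  `∫_{B_ρ(x₀)} |v(t)|² ≤ A₁` (a.e. `t ∈ (0,T)`, `A₁ < ∞`) and `∫₀ᵀ∫_{B_ρ(x₀)} |G|² ≤ A₂`,
  `∫₀ᵀ∫_{B_ρ(x₀)} |v|³ ≤ K_c A₁^{1/2} (A₁ T)^{1/4} (A₁ T + A₂)^{3/4}` — the interpolation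
  "`∫∫ |u|³ ≤ C (ess sup ‖u‖²_{L²})^{3/4}·(‖u‖²_{L²H¹})^{3/4}`" (Kang–Miura–Tsai 2021, remark after
  Lemma 3.3: "It is standard to see that `A` is finite by using properties 2–5 and the Sobolev
  embedding"; Lemarié-Rieusset 2016, (13.17)–(13.18); Caffarelli–Kohn–Nirenberg 1982,
  (2.8)–(2.10)), proved slice by slice exactly as the tree's
  `IsLocalLeraySolutionOn.exists_lintegral_cube_box_le` (slice-wise weak derivative
  `HasWeakSpatialGradientOn.ae_hasWeakFDerivOn_slice`, the slice estimate
  `lintegral_cube_le_of_sobolev`, Hölder in time `lintegral_rpow_quarter_mul_le`), but with the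
  hypotheses' constants in place of the solution's.

## Mathlib / tree search

Tree: `lintegral_mul_le_of_forall_lintegral_ball_le` (`LocalPressureFarFieldTools.lean`),
`exists_eLpNorm_six_le_ball_uniform` (`SobolevSixBall.lean`), `lintegral_cube_le_of_sobolev`,
`lintegral_rpow_quarter_mul_le`, `eLpNorm_two_eq_rpow_lintegral_sq`
(`LerayVelocityCubicDecay.lean`), `HasWeakSpatialGradientOn.ae_hasWeakFDerivOn_slice`
(`WeakGradientSlicing.lean`), `slab`, `HasWeakSpatialGradientOn` (`WeakSolution.lean`,
`SuitableWeak.lean`); the non-explicit versions `IsLocalLeraySolutionOn.exists_lintegral_cube_box_le`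
(`LocalLeraySlabCubicIntegrability.lean`), `exists_lintegral_cube_cylinder_le`
(`LocalLerayCubicIntegrability.lean`, unit cylinder centred at `0`). Mathlib: `lintegral_prod`,
`Measure.prod_restrict`, `Measure.addHaar_ball_center`, `AEMeasurable.lintegral_prod_right'`.

## References

* K. Kang, H. Miura, T.-P. Tsai, IMRN 2021 = arXiv:1812.10509, §3 remark after Lemma 3.3 and §8
  (first display of the proof of Lemma 3.4). Bib key `KangMiuraTsai2020`.
* P. G. Lemarié-Rieusset, *The Navier–Stokes problem in the 21st century* (2016), (13.17)–(13.18)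
  p. 461, proof of Thm. 14.5 p. 511. Bib key `LemarieRieusset2016`.
* L. Caffarelli, R. Kohn, L. Nirenberg, CPAM 35 (1982), (2.8)–(2.10).
-/

noncomputable section

open _root_.MeasureTheory _root_.TopologicalSpace _root_.Metric _root_.Filter _root_.Set
  _root_.Function
open scoped _root_.ENNReal _root_.NNReal _root_.Topology

namespace Literature.Analysis.FluidPDE

/-! ## Uniformly local bounds: from unit balls to balls of radius `ρ` -/

/-- **`L¹_uloc` at radius `ρ` from radius `1`.** If `g ≥ 0` is measurable with
`∫_{B_1(z)} g ≤ A` for every centre `z ∈ ℝ³`, then for every centre `x₀` and radius `ρ`,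
`∫_{B_ρ(x₀)} g ≤ |B_1|⁻¹ · A · |B_{ρ+1}|` (average the unit-ball bound over the centres
`z ∈ B_{ρ+1}(x₀)`, which cover every point of `B_ρ(x₀)` with mass `|B_1|`; the averaging lemma
`lintegral_mul_le_of_forall_lintegral_ball_le` with `W = 1_{B_ρ(x₀)}`, `w = 1_{B_{ρ+1}(x₀)}`).
This is the step "`‖·‖_{L²_{uloc,R}} ≤ C(R) ‖·‖_{L²_uloc}`" implicit in Kang–Miura–Tsai 2021, §8.
[folklore] -/
theorem setLIntegral_ball_le_of_forall_unitBall {g : EuclideanSpace ℝ (Fin 3) → ℝ≥0∞}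
    (hg : AEMeasurable g volume) {A : ℝ≥0∞}
    (hA : ∀ z : EuclideanSpace ℝ (Fin 3), ∫⁻ y in ball z 1, g y ≤ A)
    (x₀ : EuclideanSpace ℝ (Fin 3)) (ρ : ℝ) :
    ∫⁻ y in ball x₀ ρ, g y ≤ (volume (ball (0 : EuclideanSpace ℝ (Fin 3)) 1))⁻¹ *
      (A * volume (ball (0 : EuclideanSpace ℝ (Fin 3)) (ρ + 1))) := by
  set W : EuclideanSpace ℝ (Fin 3) → ℝ≥0∞ := (ball x₀ ρ).indicator 1 with hW
  set w : EuclideanSpace ℝ (Fin 3) → ℝ≥0∞ := (ball x₀ (ρ + 1)).indicator 1 with hw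
  have hwm : AEMeasurable w volume := aemeasurable_const.indicator measurableSet_ball
  have h1 : ∫⁻ y in ball x₀ ρ, g y = ∫⁻ y, g y * W y := by
    rw [← lintegral_indicator measurableSet_ball]
    refine lintegral_congr fun y => ?_
    by_cases hy : y ∈ ball x₀ ρ
    · simp [hW, hy]
    · simp [hW, hy]
  have h2 : ∫⁻ z, w z = volume (ball (0 : EuclideanSpace ℝ (Fin 3)) (ρ + 1)) := by
    rw [hw, lintegral_indicator measurableSet_ball]
    simp [Measure.addHaar_ball_center volume x₀ (ρ + 1)]
  rw [h1, ← h2]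
  refine lintegral_mul_le_of_forall_lintegral_ball_le hg hwm hA fun y z hz => ?_
  by_cases hy : y ∈ ball x₀ ρ
  · have hz' : z ∈ ball x₀ (ρ + 1) := by
      rw [mem_ball] at hy ⊢
      calc dist z x₀ ≤ dist z y + dist y x₀ := dist_triangle _ _ _
        _ < 1 + ρ := add_lt_add hz hy
        _ = ρ + 1 := add_comm _ _
    simp [hW, hw, hy, hz']
  · simp [hW, hy]

/-! ## The cubic functional with explicit constants -/

/-- **The cubic functional of a field in the uniformly local energy class, with explicit
constants** (Kang–Miura–Tsai 2021, remark after Lemma 3.3; Lemarié-Rieusset 2016,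
(13.17)–(13.18); Caffarelli–Kohn–Nirenberg 1982, (2.8)–(2.10)). For every radius `ρ` there is a
constant `K_c` (the number `(2 C_S(ρ))^{3/2}`, `C_S(ρ)` the centre-independent Sobolev constant
of the balls `B_ρ(y)`) such that: for every `T`, every field `v` with a weak spatial gradient `G`
on the slab `(0,T) × ℝ³`, every centre `x₀` and all `A₁ < ∞`, `A₂` with
`∫_{B_ρ(x₀)} |v(t)|² ≤ A₁` for a.e. `t ∈ (0,T)` and `∫₀ᵀ∫_{B_ρ(x₀)} |G|² ≤ A₂`,
`∫₀ᵀ∫_{B_ρ(x₀)} |v|³ ≤ K_c A₁^{1/2} (A₁|(0,T)|)^{1/4} (A₁|(0,T)| + A₂)^{3/4}`. Proof: for a.e. `s`,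
`∫_B |v(s)|³ ≤ (2C_S)^{3/2} a^{3/4}(a + e)^{3/4} ≤ (2C_S)^{3/2} A₁^{1/2} a^{1/4}(a + e)^{3/4}`
(`a = ∫_B |v(s)|²`, `e = ∫_B |G(s)|²`: slice-wise weak derivative, Sobolev on the ball and
Lebesgue interpolation), then Hölder in time with exponents `4, 4/3`. [folklore] -/
theorem exists_lintegral_cube_box_le_explicit (ρ : ℝ) :
    ∃ Kc : ℝ≥0, ∀ (T : ℝ) (v : ℝ → EuclideanSpace ℝ (Fin 3) → EuclideanSpace ℝ (Fin 3))
      (G : ℝ → EuclideanSpace ℝ (Fin 3) → EuclideanSpace ℝ (Fin 3) →L[ℝ] EuclideanSpace ℝ (Fin 3))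
      (x₀ : EuclideanSpace ℝ (Fin 3)) (A₁ A₂ : ℝ≥0∞), A₁ ≠ ⊤ →
      HasWeakSpatialGradientOn (slab (EuclideanSpace ℝ (Fin 3)) (Ioo 0 T) isOpen_Ioo) v G →
      (∀ᵐ t ∂(volume.restrict (Ioo 0 T)), ∫⁻ x in ball x₀ ρ, ‖v t x‖ₑ ^ 2 ≤ A₁) →
      ∫⁻ z in Ioo 0 T ×ˢ ball x₀ ρ, ENNReal.ofReal (frobeniusNormSq (G z.1 z.2)) ≤ A₂ →
      ∫⁻ z in Ioo 0 T ×ˢ ball x₀ ρ, ‖v z.1 z.2‖ₑ ^ (3 : ℕ) ≤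
        Kc * A₁ ^ (1 / 2 : ℝ) * ((A₁ * volume (Ioo (0 : ℝ) T)) ^ (1 / 4 : ℝ) *
          (A₁ * volume (Ioo (0 : ℝ) T) + A₂) ^ (3 / 4 : ℝ)) := by
  obtain ⟨CS, hCS⟩ := exists_eLpNorm_six_le_ball_uniform
    (E := EuclideanSpace ℝ (Fin 3)) finrank_euclideanSpace_three ρ
  refine ⟨(2 * CS) ^ (3 / 2 : ℝ), fun T v G x₀ A₁ A₂ hA₁top hG hA₁ hA₂ => ?_⟩
  -- ## measurability of `v` and `G` on the slab
  have hslab : ((slab (EuclideanSpace ℝ (Fin 3)) (Ioo 0 T) isOpen_Ioo :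
      Opens (ℝ × EuclideanSpace ℝ (Fin 3))) : Set (ℝ × EuclideanSpace ℝ (Fin 3))) =
      Ioo (0 : ℝ) T ×ˢ univ := rfl
  have hvm : AEStronglyMeasurable (uncurry v) (volume.restrict (Ioo (0 : ℝ) T ×ˢ univ)) := by
    rw [← hslab]
    exact hG.locallyIntegrableOn.aestronglyMeasurable
  have hGm : AEStronglyMeasurable (uncurry G) (volume.restrict (Ioo (0 : ℝ) T ×ˢ univ)) := by
    rw [← hslab]
    exact hG.locallyIntegrableOn_grad.aestronglyMeasurable
  -- ## the box
  set B := ball x₀ ρ with hB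
  set Bo : Opens (EuclideanSpace ℝ (Fin 3)) := ⟨B, isOpen_ball⟩ with hBo
  set μt : Measure ℝ := volume.restrict (Ioo (0 : ℝ) T) with hμt
  set μx := (volume.restrict B : Measure (EuclideanSpace ℝ (Fin 3))) with hμx
  have hprod : μt.prod μx = volume.restrict (Ioo 0 T ×ˢ B) := by
    rw [hμt, hμx, Measure.prod_restrict, ← Measure.volume_eq_prod]
  have hsub : Ioo 0 T ×ˢ B ⊆ Ioo (0 : ℝ) T ×ˢ univ := Set.prod_mono Subset.rfl (subset_univ _)
  have hvmB : AEStronglyMeasurable (uncurry v) (μt.prod μx) := by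
    rw [hprod]
    exact hvm.mono_measure (Measure.restrict_mono hsub le_rfl)
  have hGmB : AEStronglyMeasurable (uncurry G) (μt.prod μx) := by
    rw [hprod]
    exact hGm.mono_measure (Measure.restrict_mono hsub le_rfl)
  have hF3 : AEMeasurable (fun z : ℝ × EuclideanSpace ℝ (Fin 3) => ‖v z.1 z.2‖ₑ ^ (3 : ℕ))
      (μt.prod μx) :=
    hvmB.enorm.pow_const _
  have hF2 : AEMeasurable (fun z : ℝ × EuclideanSpace ℝ (Fin 3) => ‖v z.1 z.2‖ₑ ^ (2 : ℕ))
      (μt.prod μx) :=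
    hvmB.enorm.pow_const _
  have hFg : AEMeasurable (fun z : ℝ × EuclideanSpace ℝ (Fin 3) =>
      ENNReal.ofReal (frobeniusNormSq (G z.1 z.2))) (μt.prod μx) :=
    (continuous_frobeniusNormSq'.comp_aestronglyMeasurable hGmB).aemeasurable.ennreal_ofReal
  -- slice quantities and Tonelli
  set a : ℝ → ℝ≥0∞ := fun s => ∫⁻ x in B, ‖v s x‖ₑ ^ (2 : ℕ) with ha
  set e : ℝ → ℝ≥0∞ := fun s => ∫⁻ x in B, ENNReal.ofReal (frobeniusNormSq (G s x)) with he
  set g₃ : ℝ → ℝ≥0∞ := fun s => ∫⁻ x in B, ‖v s x‖ₑ ^ (3 : ℕ) with hg₃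
  have ha_meas : AEMeasurable a μt := hF2.lintegral_prod_right'
  have he_meas : AEMeasurable e μt := hFg.lintegral_prod_right'
  have hT3 : ∫⁻ z in Ioo 0 T ×ˢ B, ‖v z.1 z.2‖ₑ ^ (3 : ℕ) = ∫⁻ s, g₃ s ∂μt := by
    rw [← hprod, lintegral_prod _ hF3]
  have hTg : ∫⁻ z in Ioo 0 T ×ˢ B, ENNReal.ofReal (frobeniusNormSq (G z.1 z.2)) =
      ∫⁻ s, e s ∂μt := by
    rw [← hprod, lintegral_prod _ hFg]
  -- a.e. in `s`: the slice weak derivative and the energy bound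
  set Qb : Opens (ℝ × EuclideanSpace ℝ (Fin 3)) :=
    ⟨Ioo 0 T ×ˢ (Bo : Set (EuclideanSpace ℝ (Fin 3))), isOpen_Ioo.prod Bo.isOpen⟩ with hQb
  have hle : Qb ≤ slab (EuclideanSpace ℝ (Fin 3)) (Ioo 0 T) isOpen_Ioo := by
    show (Qb : Set (ℝ × EuclideanSpace ℝ (Fin 3))) ⊆ _
    rw [hslab]
    exact hsub
  have hslice : ∀ᵐ s ∂μt, FunctionSpaces.HasWeakFDerivOn Bo volume (v s) (G s) :=
    (hG.mono hle).ae_hasWeakFDerivOn_slice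
  have henergy : ∀ᵐ s ∂μt, a s ≤ A₁ := hA₁
  -- constants
  set C₃ : ℝ≥0∞ := ((2 : ℝ≥0∞) * CS) ^ (3 / 2 : ℝ) * A₁ ^ (1 / 2 : ℝ) with hC₃
  have hC₃top : C₃ ≠ ⊤ :=
    ENNReal.mul_ne_top (ENNReal.rpow_ne_top_of_nonneg (by norm_num)
      (ENNReal.mul_ne_top (by simp) ENNReal.coe_ne_top))
      (ENNReal.rpow_ne_top_of_nonneg (by norm_num) hA₁top)
  -- the pointwise slice bound
  have hpt : ∀ᵐ s ∂μt, g₃ s ≤ C₃ * (a s ^ (1 / 4 : ℝ) * (a s + e s) ^ (3 / 4 : ℝ)) := by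
    filter_upwards [hslice, henergy] with s hs hen
    have h2 : eLpNorm (v s) 2 μx ≠ ⊤ := by
      rw [hμx, eLpNorm_two_eq_rpow_lintegral_sq]
      exact ENNReal.rpow_ne_top_of_nonneg (by norm_num) (ne_top_of_le_ne_top hA₁top hen)
    have hsl := lintegral_cube_le_of_sobolev μx (hCS x₀ (v s) (G s) hs h2)
      hs.locallyIntegrableOn.aestronglyMeasurable
    have h34 : a s ^ (3 / 4 : ℝ) = a s ^ (1 / 4 : ℝ) * a s ^ (1 / 2 : ℝ) := by
      rw [← ENNReal.rpow_add_of_nonneg _ _ (by norm_num) (by norm_num)]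
      norm_num
    have hhalf : a s ^ (1 / 2 : ℝ) ≤ A₁ ^ (1 / 2 : ℝ) := ENNReal.rpow_le_rpow hen (by norm_num)
    calc g₃ s ≤ ((2 : ℝ≥0∞) * CS) ^ (3 / 2 : ℝ) * a s ^ (3 / 4 : ℝ) *
          (a s + e s) ^ (3 / 4 : ℝ) := hsl
      _ = ((2 : ℝ≥0∞) * CS) ^ (3 / 2 : ℝ) * (a s ^ (1 / 4 : ℝ) * a s ^ (1 / 2 : ℝ)) *
          (a s + e s) ^ (3 / 4 : ℝ) := by rw [h34]
      _ ≤ ((2 : ℝ≥0∞) * CS) ^ (3 / 2 : ℝ) * (a s ^ (1 / 4 : ℝ) * A₁ ^ (1 / 2 : ℝ)) *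
          (a s + e s) ^ (3 / 4 : ℝ) := by gcongr
      _ = C₃ * (a s ^ (1 / 4 : ℝ) * (a s + e s) ^ (3 / 4 : ℝ)) := by rw [hC₃]; ring
  -- the time integrals of `a` and `e`
  have hIa : ∫⁻ s, a s ∂μt ≤ A₁ * volume (Ioo (0 : ℝ) T) := by
    calc ∫⁻ s, a s ∂μt ≤ ∫⁻ _, A₁ ∂μt := lintegral_mono_ae henergy
      _ = A₁ * volume (Ioo (0 : ℝ) T) := by
          rw [lintegral_const, hμt, Measure.restrict_apply_univ]
  have hIe : ∫⁻ s, e s ∂μt ≤ A₂ := by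
    rw [← hTg]
    exact hA₂
  have hIae : ∫⁻ s, (a s + e s) ∂μt ≤ A₁ * volume (Ioo (0 : ℝ) T) + A₂ := by
    rw [lintegral_add_left' ha_meas]
    exact add_le_add hIa hIe
  -- integrate the slice bound
  calc ∫⁻ z in Ioo 0 T ×ˢ B, ‖v z.1 z.2‖ₑ ^ (3 : ℕ) = ∫⁻ s, g₃ s ∂μt := hT3
    _ ≤ ∫⁻ s, C₃ * (a s ^ (1 / 4 : ℝ) * (a s + e s) ^ (3 / 4 : ℝ)) ∂μt :=
        lintegral_mono_ae hpt
    _ = C₃ * ∫⁻ s, a s ^ (1 / 4 : ℝ) * (a s + e s) ^ (3 / 4 : ℝ) ∂μt :=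
        lintegral_const_mul' _ _ hC₃top
    _ ≤ C₃ * ((∫⁻ s, a s ∂μt) ^ (1 / 4 : ℝ) * (∫⁻ s, (a s + e s) ∂μt) ^ (3 / 4 : ℝ)) := by
        gcongr
        exact lintegral_rpow_quarter_mul_le μt ha_meas (ha_meas.add he_meas)
    _ ≤ C₃ * ((A₁ * volume (Ioo (0 : ℝ) T)) ^ (1 / 4 : ℝ) *
          (A₁ * volume (Ioo (0 : ℝ) T) + A₂) ^ (3 / 4 : ℝ)) := by
        gcongr
    _ = (((2 * CS) ^ (3 / 2 : ℝ) : ℝ≥0) : ℝ≥0∞) * A₁ ^ (1 / 2 : ℝ) *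
          ((A₁ * volume (Ioo (0 : ℝ) T)) ^ (1 / 4 : ℝ) *
            (A₁ * volume (Ioo (0 : ℝ) T) + A₂) ^ (3 / 4 : ℝ)) := by
        rw [hC₃, ENNReal.coe_rpow_of_nonneg _ (by norm_num), ENNReal.coe_mul, ENNReal.coe_ofNat]

end Literature.Analysis.FluidPDE

end
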